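import Mathlib
import HarnessLib
import Summits.NavierStokesRegularity.NavierStokesRegularity.Theorems.HalfSpaceWindowDoorCirculationCarryingRigidityFlatLiouville
import Summits.NavierStokesRegularity.NavierStokesRegularity.Theorems.HalfSpaceWindowDoorCirculationCarryingRigidityEddyStrata

/-!
# Route `HalfSpaceWindowDoor`, crux `CirculationCarryingRigidity` (stmt-NavierStokesRegularity-25311) — line `eddy_covariance`:
# the RESIDUE OF W6 after g10 in its sharpest form, and the PORTRAIT of the enemy

LEAD ns-hsw-p1 g10, `--supports 25311 --as helper`; card `Cruxes/…/Lines/eddy_covariance.md`.  Composition of `…FlatLiouville`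
(W6 ⟸ the eddy bound on flat, growing, locally-maximal record far circles) with `…EddyStrata.remainder_le_eddyLift_add`
(`ℛ ≤ E + (2C/√(−t))∮ω₃ dl`, `E = ∮(v_z − v̄_z)ω_r dl` the EDDY LIFT):

* `inner_curl_e3_eq_zero_of_flatEddyLiftBound` / `hemisphereLiouvilleE3_of_flatEddyLiftBound` — **W6 = `HemisphereLiouvilleE3` HOLDS AS SOON AS**
  every closed-hemisphere door-class profile `v` (constant `C`) admits `B, R₀ ≥ 0`, `σ₀ < 0`, `η > 0` such that the EDDY-LIFT bound
  `∮_{S(r,z)} (v_z − v̄_z) ω_r dl ≤ (B/√(−t)) (∮_{S(r,z)} ω₃ dl + |∮_{S(r,z)} ω_r dl|)`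
  holds at every time `t ≤ σ₀` on every circle `S(r,z)` about the `e₃`-axis which is (a) FAR: `r ≥ R₀√(−t)`; (b) a RECORD:
  `Γ(r,z,t) > Γ(R₁√(−s'),z',s')` for all `s' ≤ t`, `z'`, `R₁ = 4(B+3C) + R₀ + 1`; (c) FLAT: `∮ω₃ dl ≤ ηr/√(−t)` and `|∮ω_r dl| ≤ ηr/√(−t)`;
  (d) GROWING: `∂ₜΓ(r,z,t) > 0`; (e) `η`-LOCALLY MAXIMAL: `Γ(r',z',t) ≤ Γ(r,z,t) + ηr²/√(−t)` for all `0 ≤ r' ≤ 2r`, `|z' − z| ≤ r`.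
* `enemy_portrait` — the census reading: a circulation-carrying closed-hemisphere door-class profile has, for ALL `B, R₀ ≥ 0`, `η > 0` and EVERY
  far-past epoch `σ₀`, a time `t ≤ σ₀` and a circle with (a)–(e) on which the eddy lift EXCEEDS `(B/√(−t))(∮ω₃ dl + |∮ω_r dl|)`: eddies
  (azimuthally correlated fluctuations of vertical velocity and radial vorticity — vortex lines weaving in and out of the cylinder wall, entering
  where the fluid rises) pump vertical-vorticity flux into a disc which already carries more flux than every tube-boundary disc so far and than
  every comparable nearby disc, through a boundary circle carrying almost no vorticity flux of either kind, while its circulation grows.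
WHAT THIS IS NOT: not about NS regularity (Clay A); HYPOTHETICAL blow-up profiles (KNSS ancient mild solutions); the item stays OPEN at its
research stub `stub_layerExclusion ≡ HemisphereLiouvilleE3`; nothing is closed by this file.
-/

noncomputable section

-- the summit and its single sub-problem share the name (CONVENTIONS §1), as in every Theorems file
set_option linter.dupNamespace false

namespace Summit.NavierStokesRegularity.NavierStokesRegularity.Theorems.HalfSpaceWindowDoorCirculationCarryingRigidityFlatStrata

open MeasureTheory Set Function Filter Topology InnerProductSpace
open scoped RealInnerProductSpace InnerProductSpace
open Literature.Analysis Literature.Analysis.UnboundedOperators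
open Literature.Analysis.FluidPDE hiding eR
open Summit.NavierStokesRegularity.NavierStokesRegularity.Theorems.HalfSpaceWindowDoorCirculationCarryingRigidityDefs
  (InDoorClass SignE3 e3 HemisphereLiouvilleE3)
open Summit.NavierStokesRegularity.NavierStokesRegularity.Theorems.AxisTwistDoorAveragedConeLiouvilleDefs
  (cylPt eR circ vortCirc radVortCirc meanZ remainder)
open Summit.NavierStokesRegularity.NavierStokesRegularity.Theorems.AveragedConeLiouville.CircMonotone (vortCirc_nonneg)
open Summit.NavierStokesRegularity.NavierStokesRegularity.Theorems.HalfSpaceWindowDoorCirculationCarryingRigidityConeFluxSubsolution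
  (signE3_atd)
open Summit.NavierStokesRegularity.NavierStokesRegularity.Theorems.HalfSpaceWindowDoorCirculationCarryingRigidityEddyStrata
  (remainder_le_eddyLift_add)
open Summit.NavierStokesRegularity.NavierStokesRegularity.Theorems.HalfSpaceWindowDoorCirculationCarryingRigidityFlatLiouville
  (inner_curl_e3_eq_zero_of_flatEddyBound)

-- AxisTwistDoor's `e₃` (the same vector as the route's `Defs.e3`) under the name `e3A`
open Summit.NavierStokesRegularity.NavierStokesRegularity.Theorems.AxisTwistDoorAveragedConeLiouvilleDefs renaming e3 → e3A

variable {C : ℝ} {v : ℝ → EuclideanSpace ℝ (Fin 3) → EuclideanSpace ℝ (Fin 3)}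

/-- **W6 ⟸ THE EDDY-LIFT BOUND ON FLAT, GROWING, LOCALLY-MAXIMAL RECORD FAR CIRCLES** (the residue of W6 after g10). -/
theorem inner_curl_e3_eq_zero_of_flatEddyLiftBound (hv : InDoorClass C v) (hsign : SignE3 v) {B : ℝ} (hB : 0 ≤ B)
    {R₀ : ℝ} (hR₀ : 0 ≤ R₀) {σ₀ : ℝ} (hσ₀ : σ₀ < 0) {η : ℝ} (hη : 0 < η)
    (hE : ∀ t : ℝ, t ≤ σ₀ → ∀ r : ℝ, R₀ * Real.sqrt (-t) ≤ r → ∀ z : ℝ,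
      (∀ s' : ℝ, s' ≤ t → ∀ z' : ℝ, circ v ((4 * (B + 2 * C + C) + R₀ + 1) * Real.sqrt (-s')) z' s' < circ v r z t) →
      vortCirc v r z t ≤ η * r / Real.sqrt (-t) → |radVortCirc v r z t| ≤ η * r / Real.sqrt (-t) →
      0 < deriv (fun σ => circ v r z σ) t →
      (∀ r' : ℝ, 0 ≤ r' → r' ≤ 2 * r → ∀ z' : ℝ, |z' - z| ≤ r → circ v r' z' t ≤ circ v r z t + η * r ^ 2 / Real.sqrt (-t)) →
      (∫ θ in (0 : ℝ)..(2 * Real.pi), (⟪v t (cylPt r θ z), e3A⟫ - meanZ v r z t) * ⟪curl (v t) (cylPt r θ z), eR θ⟫ * r) ≤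
        B / Real.sqrt (-t) * (vortCirc v r z t + |radVortCirc v r z t|)) :
    ∀ s < 0, ∀ y, ⟪curl (v s) y, e3⟫ = 0 := by
  have hC : 0 ≤ C := HalfSpaceWindowDoorCirculationCarryingRigidityConeFluxSubsolution.typeI_const_nonneg hv
  have hB' : 0 ≤ B + 2 * C := by positivity
  refine inner_curl_e3_eq_zero_of_flatEddyBound hv hsign hB' hR₀ hσ₀ hη fun t ht r hr z hrec h1 h2 h3 h4 => ?_
  have ht0 : t < 0 := lt_of_le_of_lt ht hσ₀
  have hsq : 0 < Real.sqrt (-t) := Real.sqrt_pos.2 (neg_pos.2 ht0)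
  have hr0 : 0 ≤ r := le_trans (by positivity) hr
  have h5 := remainder_le_eddyLift_add hv hsign ht0 hr0 z
  have h6 := hE t ht r hr z hrec h1 h2 h3 h4
  have hΓr : 0 ≤ vortCirc v r z t := vortCirc_nonneg v (signE3_atd hsign) ht0 hr0 _
  have e : (B + 2 * C) / Real.sqrt (-t) * (vortCirc v r z t + |radVortCirc v r z t|) =
      B / Real.sqrt (-t) * (vortCirc v r z t + |radVortCirc v r z t|) + 2 * C / Real.sqrt (-t) * vortCirc v r z t +
        2 * C / Real.sqrt (-t) * |radVortCirc v r z t| := by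
    field_simp
    ring
  rw [e]
  have : 0 ≤ 2 * C / Real.sqrt (-t) * |radVortCirc v r z t| := by positivity
  linarith

/-- **BY-NAME REDUCTION of W6 to the eddy-lift bound on flat, growing, locally-maximal record far circles.** -/
theorem hemisphereLiouvilleE3_of_flatEddyLiftBound
    (H : ∀ (C : ℝ) (v : ℝ → EuclideanSpace ℝ (Fin 3) → EuclideanSpace ℝ (Fin 3)), InDoorClass C v → SignE3 v →
      ∃ B : ℝ, 0 ≤ B ∧ ∃ R₀ : ℝ, 0 ≤ R₀ ∧ ∃ σ₀ : ℝ, σ₀ < 0 ∧ ∃ η : ℝ, 0 < η ∧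
        ∀ t : ℝ, t ≤ σ₀ → ∀ r : ℝ, R₀ * Real.sqrt (-t) ≤ r → ∀ z : ℝ,
          (∀ s' : ℝ, s' ≤ t → ∀ z' : ℝ, circ v ((4 * (B + 2 * C + C) + R₀ + 1) * Real.sqrt (-s')) z' s' < circ v r z t) →
          vortCirc v r z t ≤ η * r / Real.sqrt (-t) → |radVortCirc v r z t| ≤ η * r / Real.sqrt (-t) →
          0 < deriv (fun σ => circ v r z σ) t →
          (∀ r' : ℝ, 0 ≤ r' → r' ≤ 2 * r → ∀ z' : ℝ, |z' - z| ≤ r →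
            circ v r' z' t ≤ circ v r z t + η * r ^ 2 / Real.sqrt (-t)) →
          (∫ θ in (0 : ℝ)..(2 * Real.pi), (⟪v t (cylPt r θ z), e3A⟫ - meanZ v r z t) * ⟪curl (v t) (cylPt r θ z), eR θ⟫ * r) ≤
            B / Real.sqrt (-t) * (vortCirc v r z t + |radVortCirc v r z t|)) :
    HemisphereLiouvilleE3 := by
  intro C v hrate hcont hmild hdiv hnn
  have hv : InDoorClass C v := ⟨hrate, hcont, hmild, hdiv⟩
  obtain ⟨B, hB, R₀, hR₀, σ₀, hσ₀, η, hη, hE⟩ := H C v hv hnn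
  exact inner_curl_e3_eq_zero_of_flatEddyLiftBound hv hnn hB hR₀ hσ₀ hη hE

/-- **PORTRAIT OF THE ENEMY (census reading after g10).**  A circulation-carrying closed-hemisphere door-class profile has, for ALL `B, R₀ ≥ 0`,
`η > 0` and EVERY epoch `σ₀ < 0`, a time `t ≤ σ₀` and a circle `S(r,z)` about the axis which is FAR (`r ≥ R₀√(−t)`), a RECORD, FLAT
(`∮ω₃ dl ≤ ηr/√(−t)`, `|∮ω_r dl| ≤ ηr/√(−t)`), GROWING (`∂ₜΓ > 0`) and `η`-LOCALLY MAXIMAL, into which the EDDY LIFT pumps flux faster than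
`(B/√(−t))(∮ω₃ dl + |∮ω_r dl|)`. -/
theorem enemy_portrait (hv : InDoorClass C v) (hsign : SignE3 v) (hpos : ∃ σ < 0, ∃ y, 0 < ⟪curl (v σ) y, e3⟫)
    {B : ℝ} (hB : 0 ≤ B) {R₀ : ℝ} (hR₀ : 0 ≤ R₀) {σ₀ : ℝ} (hσ₀ : σ₀ < 0) {η : ℝ} (hη : 0 < η) :
    ∃ t : ℝ, t ≤ σ₀ ∧ ∃ r : ℝ, R₀ * Real.sqrt (-t) ≤ r ∧ ∃ z : ℝ,
      (∀ s' : ℝ, s' ≤ t → ∀ z' : ℝ, circ v ((4 * (B + 2 * C + C) + R₀ + 1) * Real.sqrt (-s')) z' s' < circ v r z t) ∧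
      vortCirc v r z t ≤ η * r / Real.sqrt (-t) ∧ |radVortCirc v r z t| ≤ η * r / Real.sqrt (-t) ∧
      0 < deriv (fun σ => circ v r z σ) t ∧
      (∀ r' : ℝ, 0 ≤ r' → r' ≤ 2 * r → ∀ z' : ℝ, |z' - z| ≤ r → circ v r' z' t ≤ circ v r z t + η * r ^ 2 / Real.sqrt (-t)) ∧
      B / Real.sqrt (-t) * (vortCirc v r z t + |radVortCirc v r z t|) <
        ∫ θ in (0 : ℝ)..(2 * Real.pi), (⟪v t (cylPt r θ z), e3A⟫ - meanZ v r z t) * ⟪curl (v t) (cylPt r θ z), eR θ⟫ * r := by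
  by_contra h
  push Not at h
  obtain ⟨σ, hσ, y, hy⟩ := hpos
  have h0 := inner_curl_e3_eq_zero_of_flatEddyLiftBound hv hsign hB hR₀ hσ₀ hη
    (fun t ht r hr z hrec h1 h2 h3 h4 => h t ht r hr z hrec h1 h2 h3 h4) σ hσ y
  exact hy.ne' h0

end Summit.NavierStokesRegularity.NavierStokesRegularity.Theorems.HalfSpaceWindowDoorCirculationCarryingRigidityFlatStrata

end
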